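import Summits.ResolutionOfSingularities.ResolutionOfSingularities.Theorems.HomologicalConductorNoZenoThreadLocalisation
import Summits.ResolutionOfSingularities.ResolutionOfSingularities.Theorems.HomologicalConductorNoZenoParasiteLocPrime
import HarnessLib

/-!
# Crux `NoZenoR` / `NoZeno` (stmt-ResolutionOfSingularities-19943 / -16483), β layer:
# the thread germs `D_m = (T_m)_(P_m)` as subrings of `K` — BRIDGE to `Localization.AtPrime`
# and the THREAD STEP (`D_(m+1)` is the local ring of `NBl_(I_m)(D_m)` under `P_(m+1)`)

Route `ResolutionOfSingularities/HomologicalConductor`.  OURS (cell res-hironaka, chain W4.4); nothing here is a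
statement of the manuscript under review, and nothing here asserts a Theses declaration.  Continues
`…NoZenoThreadLocalisation` (T-SURF, p518180) in the `Parasite` vocabulary, where the germ of a singular prime
thread at stage `m` is the explicit fraction subring `D_m := Parasite.locPrime (tower O A m) (P m)` of `K`.

* BRIDGE: `locPrime T P` IS a localisation of `T` at `P` (`isLocalization_locPrime`, for the algebra structure
  given by the inclusion), hence ring-isomorphic over `T` to `Localization.AtPrime P`
  (`exists_ringEquiv_locPrime`); so it is integrally closed when `T` is (`isIntegrallyClosed_locPrime`), its
  Krull dimension is `height P` (`ringKrullDim_locPrime`), and it is regular iff `Localization.AtPrime P` is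
  (`isRegularLocalRing_locPrime_iff`).
* THREAD STEP (CHAIN W4.4 v12 §3.3, first clause; ruling res-L0-w44-plan-1 g13 09:33:33Z (ρ1)): along a
  compatible pair of thread primes `P ⊆ T_m`, `P' ⊆ T_(m+1)`, for ANY admissible denominator `x ∈ ca(T_m)`
  (nonzero, of minimal `O`-value — a binder, so the statement is reusable chart by chart), with
  `B := k[D_m ∪ ca(T_m)·x⁻¹]` (the `x`-chart `D_m[I_m/x]` of the blow-up of `D_m` at `I_m = ca(T_m)·D_m`):
  (S1) `B ≤ D_(m+1)` (`adjoin_locPrime_le_locPrime_succ`) and `nrm B ≤ D_(m+1)`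
  (`nrm_adjoin_locPrime_le_locPrime_succ`, via `mem_locPrime_of_isIntegral`);
  (S2) **`(nrm B)_𝔮 = D_(m+1)`** for the prime `𝔮` of `nrm B` of non-units of `D_(m+1)`
  (`locPrime_succ_eq_locPrime_nrm_adjoin`): the next germ IS the local ring of the normalised blow-up of
  `D_m` along `I_m` at the point under `P_(m+1)` — proof by saturation (`locPrime_le_and_saturated`): `(nrm B)_𝔮`
  contains the whole `O`-chart `T_m[ca/x']` (each `x'·x⁻¹` is a unit), hence its normalisation (integrality
  descends along the localisation), hence `T_(m+1)` and `(T_(m+1))_(P')`;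
  (S3) `ca(T_m)·D_(m+1) = x·D_(m+1)` (`span_ca_eq_span_singleton`).
  NOT claimed: anything about `I_(m+1)` versus the transform of `I_m`, nor regularity of any germ.

References: S. Iyengar, R. Takahashi, IMRN 2016 [`IyengarTakahashi2014`] (the ideal `ca`); M. Atiyah,
I. Macdonald (1969), Prop. 3.11 / Cor. 5.5 (localisation at a prime; integral closure) [`AtiyahMacdonald1969`].
-/

noncomputable section

-- single-problem summit: the doubled namespace component `ResolutionOfSingularities` is forced
set_option linter.dupNamespace false

namespace Summit.ResolutionOfSingularities.ResolutionOfSingularities.Theorems.NoZeno.SandwichCluster.Thread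

open IsLocalRing
open Summit.ResolutionOfSingularities.ResolutionOfSingularities.Theses.HomologicalConductor
open Summit.ResolutionOfSingularities.ResolutionOfSingularities.Theorems.NoZeno.Birth
open Parasite (locPrime mem_locPrime_of_mem inv_mem_locPrime_of_not_mem)

variable {k K : Type} [Field k] [Field K] [Algebra k K]

/-! ## BRIDGE: `locPrime T P` is the localisation of `T` at `P` -/

section Bridge

variable (T : Subalgebra k K) (P : Ideal ↥T) (hP : P.IsPrime)

/-- `T ≤ locPrime T P` as subrings of `K`. [this work] -/
theorem toSubring_le_locPrime : T.toSubring ≤ locPrime T P hP :=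
  fun _ hs => mem_locPrime_of_mem T P hP (Subalgebra.mem_toSubring.mp hs)

/-- For the algebra structure `T → locPrime T P` given by the inclusion of subrings of `K`,
**`locPrime T P` is a localisation of `T` at `P`** (units: elements off `P` are inverted; surjectivity:
every element is `a * b⁻¹` with `b ∉ P`; injectivity: everything happens inside the field `K`).
[cite: AtiyahMacdonald1969, Prop. 3.11] [folklore] -/
theorem isLocalization_locPrime :
    @IsLocalization.AtPrime ↥T _ ↥(locPrime T P hP) _
      (Subring.inclusion (toSubring_le_locPrime T P hP)).toAlgebra P hP := by
  letI : Algebra ↥T ↥(locPrime T P hP) := (Subring.inclusion (toSubring_le_locPrime T P hP)).toAlgebra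
  have halg : ∀ t : ↥T, (algebraMap ↥T ↥(locPrime T P hP) t : K) = t := fun _ => rfl
  refine (isLocalization_iff _ _).mpr ⟨?_, ?_, ?_⟩
  · -- elements off `P` become units
    rintro ⟨s, hs⟩
    have hsP : s ∉ P := hs
    have hinv : (s : K)⁻¹ ∈ locPrime T P hP := inv_mem_locPrime_of_not_mem T P hP s.2 (by simpa using hsP)
    have hs0 : (s : K) ≠ 0 := fun h => hsP (by
      have : s = 0 := Subtype.ext h
      rw [this]; exact P.zero_mem)
    refine IsUnit.of_mul_eq_one ⟨(s : K)⁻¹, hinv⟩ (Subtype.ext ?_)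
    change (s : K) * (s : K)⁻¹ = 1
    exact mul_inv_cancel₀ hs0
  · -- every element is a fraction `a / b`, `b ∉ P`
    rintro ⟨y, a, b, ha, hb, hbP, rfl⟩
    refine ⟨(⟨a, ha⟩, ⟨⟨b, hb⟩, hbP⟩), Subtype.ext ?_⟩
    have hb0 : b ≠ 0 := Parasite.ne_zero_of_not_mem_ideal T P hb hbP
    change a * b⁻¹ * b = a
    rw [mul_assoc, inv_mul_cancel₀ hb0, mul_one]
  · -- the structure map is injective
    intro x y hxy
    refine ⟨1, ?_⟩
    have : (x : K) = y := by
      have h := congrArg (fun z : ↥(locPrime T P hP) => (z : K)) hxy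
      simpa [halg] using h
    simpa using Subtype.ext this

/-- **`locPrime T P ≅ Localization.AtPrime P`** by a ring isomorphism compatible with the maps from `T`.
[cite: AtiyahMacdonald1969, Prop. 3.11] [folklore] -/
theorem exists_ringEquiv_locPrime :
    ∃ e : Localization.AtPrime P ≃+* ↥(locPrime T P hP),
      ∀ t : ↥T, (e (algebraMap ↥T (Localization.AtPrime P) t) : K) = t := by
  letI : Algebra ↥T ↥(locPrime T P hP) := (Subring.inclusion (toSubring_le_locPrime T P hP)).toAlgebra
  haveI := isLocalization_locPrime T P hP
  refine ⟨(IsLocalization.algEquiv P.primeCompl (Localization.AtPrime P) ↥(locPrime T P hP)).toRingEquiv,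
    fun t => ?_⟩
  change ((IsLocalization.algEquiv P.primeCompl (Localization.AtPrime P) ↥(locPrime T P hP))
    (algebraMap ↥T (Localization.AtPrime P) t) : K) = t
  rw [AlgEquiv.commutes]
  rfl

/-- `locPrime T P` is integrally closed when `T` is a normal domain. [cite: AtiyahMacdonald1969, Prop. 5.12]
[folklore] -/
theorem isIntegrallyClosed_locPrime [IsIntegrallyClosed ↥T] : IsIntegrallyClosed ↥(locPrime T P hP) := by
  letI : Algebra ↥T ↥(locPrime T P hP) := (Subring.inclusion (toSubring_le_locPrime T P hP)).toAlgebra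
  haveI := isLocalization_locPrime T P hP
  exact isIntegrallyClosed_of_isLocalization ↥(locPrime T P hP) P.primeCompl P.primeCompl_le_nonZeroDivisors

/-- `dim (locPrime T P) = height P`. [folklore] -/
theorem ringKrullDim_locPrime : ringKrullDim ↥(locPrime T P hP) = P.height := by
  letI : Algebra ↥T ↥(locPrime T P hP) := (Subring.inclusion (toSubring_le_locPrime T P hP)).toAlgebra
  haveI := isLocalization_locPrime T P hP
  exact IsLocalization.AtPrime.ringKrullDim_eq_height P ↥(locPrime T P hP)

/-- `locPrime T P` is regular iff `Localization.AtPrime P` is. [folklore] -/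
theorem isRegularLocalRing_locPrime_iff :
    IsRegularLocalRing ↥(locPrime T P hP) ↔ IsRegularLocalRing (Localization.AtPrime P) := by
  obtain ⟨e, -⟩ := exists_ringEquiv_locPrime T P hP
  exact ⟨fun h => IsRegularLocalRing.of_ringEquiv (R := ↥(locPrime T P hP)) e.symm,
    fun h => IsRegularLocalRing.of_ringEquiv e⟩

end Bridge

/-! ## Small tools on subrings of `K` -/

section Tools

/-- A `k`-subalgebra generated inside a subring of `K` containing the constants stays inside it.
[folklore] -/
theorem adjoin_subset_of_subset (S : Subring K) (hkS : ∀ c : k, algebraMap k K c ∈ S) {s : Set K}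
    (hs : s ⊆ S) : ((Algebra.adjoin k s : Subalgebra k K) : Set K) ⊆ S := by
  let S' : Subalgebra k K := { S.toSubsemiring with algebraMap_mem' := hkS }
  have h : Algebra.adjoin k s ≤ S' := Algebra.adjoin_le hs
  intro y hy
  exact h hy

variable (T : Subalgebra k K) (P : Ideal ↥T) (hP : P.IsPrime)

/-- **Saturation.** Let `S ⊆ locPrime T P =: D` be a `k`-subalgebra and `𝔮 ⊆ S` the prime of
elements that are NOT units of the local ring `D`.  Then the explicit localisation `S_𝔮 = locPrime S 𝔮`
lies in `D`, and an element of `S_𝔮` which is a unit of `D` is a unit of `S_𝔮`. [folklore] -/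
theorem locPrime_le_and_saturated (S : Subalgebra k K) (hSD : (S : Set K) ⊆ locPrime T P hP)
    (𝔮 : Ideal ↥S) (h𝔮 : 𝔮.IsPrime)
    (hmem : ∀ b : ↥S, b ∉ 𝔮 ↔ ((b : K) ≠ 0 ∧ (b : K)⁻¹ ∈ locPrime T P hP)) :
    (locPrime S 𝔮 h𝔮 : Set K) ⊆ locPrime T P hP ∧
      ∀ y ∈ locPrime S 𝔮 h𝔮, y⁻¹ ∈ locPrime T P hP → y⁻¹ ∈ locPrime S 𝔮 h𝔮 := by
  have hle : (locPrime S 𝔮 h𝔮 : Set K) ⊆ locPrime T P hP := by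
    rintro y ⟨a, b, ha, hb, hb𝔮, rfl⟩
    obtain ⟨-, hbinv⟩ := (hmem ⟨b, hb⟩).mp hb𝔮
    exact (locPrime T P hP).mul_mem (hSD ha) hbinv
  refine ⟨hle, ?_⟩
  rintro y ⟨a, b, ha, hb, hb𝔮, rfl⟩ hyinv
  obtain ⟨hb0, hbinv⟩ := (hmem ⟨b, hb⟩).mp hb𝔮
  by_cases ha0 : a = 0
  · -- `y = 0`, `y⁻¹ = 0`
    simp only [ha0, zero_mul, inv_zero]
    exact (locPrime S 𝔮 h𝔮).zero_mem
  · -- `a = y * b` is a unit of `D`, hence `a ∉ 𝔮` and `y⁻¹ = b * a⁻¹`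
    have hainv : a⁻¹ ∈ locPrime T P hP := by
      have h1 : a⁻¹ = (a * b⁻¹)⁻¹ * b⁻¹ := by
        rw [mul_inv, inv_inv]; field_simp
      rw [h1]
      exact (locPrime T P hP).mul_mem hyinv hbinv
    have ha𝔮 : (⟨a, ha⟩ : ↥S) ∉ 𝔮 := (hmem ⟨a, ha⟩).mpr ⟨ha0, hainv⟩
    refine ⟨b, a, hb, ha, ha𝔮, ?_⟩
    rw [mul_inv, inv_inv, mul_comm]

end Tools

/-! ## THREAD STEP: `D_(m+1)` is the local ring of `NBl_(I_m)(D_m)` under `P_(m+1)` -/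

section Step

variable (O : ValuationSubring K) (A : Subalgebra k K)

/-- Along a compatible pair of thread primes `P ⊆ T_m`, `P' ⊆ T_(m+1)` (an element of `T_m` lying in `P'`
lies in `P`), the germ grows: `D_m = (T_m)_P ≤ (T_(m+1))_(P') = D_(m+1)`. [this work] -/
theorem locPrime_le_locPrime_succ (m : ℕ) (P : Ideal ↥(tower O A m)) (hP : P.IsPrime)
    (P' : Ideal ↥(tower O A (m + 1))) (hP' : P'.IsPrime)
    (hcompat : ∀ (x : K) (hx : x ∈ tower O A m) (hx' : x ∈ tower O A (m + 1)),
      (⟨x, hx'⟩ : ↥(tower O A (m + 1))) ∈ P' → (⟨x, hx⟩ : ↥(tower O A m)) ∈ P) :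
    (locPrime (tower O A m) P hP : Set K) ⊆ locPrime (tower O A (m + 1)) P' hP' := by
  -- adapted from `Parasite.singularThread_of_singularPrimeThread` (first domination clause)
  rintro y ⟨a, b, ha, hb, hbP, rfl⟩
  have hmono : ∀ {x : K}, x ∈ tower O A m → x ∈ tower O A (m + 1) := fun hx =>
    d2rc_mem_tower_of_le O A (Nat.le_succ m) hx
  exact ⟨a, b, hmono ha, hmono hb, fun h => hbP (hcompat b hb (hmono hb) h), rfl⟩

/-- The `x`-chart generators `c * x⁻¹` (`c ∈ ca(T_m)`, `x` an admissible denominator: nonzero, in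
`ca(T_m)`, of minimal `O`-value) lie in `T_(m+1)`. [this work] -/
theorem mul_inv_mem_tower_succ (m : ℕ) {x : K} (hxca : x ∈ ca (tower O A m)) (hx0 : x ≠ 0)
    (hxmin : ∀ c ∈ ca (tower O A m), c * x⁻¹ ∈ O) {c : K} (hc : c ∈ ca (tower O A m)) :
    c * x⁻¹ ∈ tower O A (m + 1) := by
  rw [tower_succ]
  exact chart_le_loc_nrm_chart O (tower O A m)
    (Algebra.subset_adjoin (Or.inr ⟨c, hc, x, hxca, hx0, hxmin, rfl⟩))

/-- **(S1a)** The `x`-chart `B = k[D_m ∪ ca(T_m)·x⁻¹]` of the blow-up of `D_m` at `I_m = ca(T_m)·D_m` lies in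
`D_(m+1)`. [this work] -/
theorem adjoin_locPrime_le_locPrime_succ (m : ℕ) (P : Ideal ↥(tower O A m)) (hP : P.IsPrime)
    (P' : Ideal ↥(tower O A (m + 1))) (hP' : P'.IsPrime)
    (hcompat : ∀ (x : K) (hx : x ∈ tower O A m) (hx' : x ∈ tower O A (m + 1)),
      (⟨x, hx'⟩ : ↥(tower O A (m + 1))) ∈ P' → (⟨x, hx⟩ : ↥(tower O A m)) ∈ P)
    {x : K} (hxca : x ∈ ca (tower O A m)) (hx0 : x ≠ 0) (hxmin : ∀ c ∈ ca (tower O A m), c * x⁻¹ ∈ O)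
    (B : Subalgebra k K)
    (hB : B = Algebra.adjoin k ((locPrime (tower O A m) P hP : Set K) ∪
      {y : K | ∃ c ∈ ca (tower O A m), y = c * x⁻¹})) :
    (B : Set K) ⊆ locPrime (tower O A (m + 1)) P' hP' := by
  subst hB
  refine adjoin_subset_of_subset _ (fun c => mem_locPrime_of_mem _ _ _ ((tower O A (m + 1)).algebraMap_mem c)) ?_
  rintro y (hy | ⟨c, hc, rfl⟩)
  · exact locPrime_le_locPrime_succ O A m P hP P' hP' hcompat hy
  · exact mem_locPrime_of_mem _ _ _ (mul_inv_mem_tower_succ O A m hxca hx0 hxmin hc)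

/-- Integral elements over a subring of `D' = (T')_(P')` (`T'` a normal stage with fraction field `K`) lie in
`D'`: clear the denominator by an element off `P'` (localisation), land in the integrally closed `T'`.
[cite: AtiyahMacdonald1969, Prop. 5.12] [folklore] -/
theorem mem_locPrime_of_isIntegral (T' : Subalgebra k K) [IsIntegrallyClosed ↥T'] [IsFractionRing ↥T' K]
    (P' : Ideal ↥T') (hP' : P'.IsPrime) (S : Subalgebra k K) (hS : (S : Set K) ⊆ locPrime T' P' hP')
    {y : K} (hy : IsIntegral ↥S y) : y ∈ locPrime T' P' hP' := by
  have hS' : S.toSubring ≤ locPrime T' P' hP' := fun z hz => hS hz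
  letI algS : Algebra ↥S ↥(locPrime T' P' hP') := (Subring.inclusion hS').toAlgebra
  haveI : IsScalarTower ↥S ↥(locPrime T' P' hP') K := IsScalarTower.of_algebraMap_eq fun _ => rfl
  have hyD : IsIntegral ↥(locPrime T' P' hP') y := hy.tower_top
  letI algT : Algebra ↥T' ↥(locPrime T' P' hP') :=
    (Subring.inclusion (toSubring_le_locPrime T' P' hP')).toAlgebra
  haveI := isLocalization_locPrime T' P' hP'
  haveI : IsScalarTower ↥T' ↥(locPrime T' P' hP') K := IsScalarTower.of_algebraMap_eq fun _ => rfl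
  obtain ⟨⟨s, hsP⟩, hsy⟩ :=
    IsIntegral.exists_multiple_integral_of_isLocalization P'.primeCompl y hyD
  have hsy' : IsIntegral ↥T' ((s : K) * y) := by simpa [Algebra.smul_def] using hsy
  obtain ⟨t, ht⟩ := (isIntegrallyClosed_iff K).mp ‹IsIntegrallyClosed ↥T'› hsy'
  have hsP' : s ∉ P' := hsP
  have hs0 : (s : K) ≠ 0 := Parasite.ne_zero_of_not_mem_ideal T' P' s.2 (by simpa using hsP')
  have hty : (t : K) = (s : K) * y := ht
  have : y = (t : K) * (s : K)⁻¹ := by rw [hty]; field_simp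
  rw [this]
  exact ⟨t, s, t.2, s.2, by simpa using hsP', rfl⟩

/-- **(S1b)** The normalisation of the chart lies in `D_(m+1)` too (`D_(m+1)` is a localisation of the normal
stage `T_(m+1)`). [this work] -/
theorem nrm_adjoin_locPrime_le_locPrime_succ (hk : ∀ c : k, algebraMap k K c ∈ O) (hA : A.FG)
    (hfr : IsFractionRing ↥A K) (hAO : A.toSubring ≤ O.toSubring)
    (m : ℕ) (P : Ideal ↥(tower O A m)) (hP : P.IsPrime)
    (P' : Ideal ↥(tower O A (m + 1))) (hP' : P'.IsPrime)
    (hcompat : ∀ (x : K) (hx : x ∈ tower O A m) (hx' : x ∈ tower O A (m + 1)),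
      (⟨x, hx'⟩ : ↥(tower O A (m + 1))) ∈ P' → (⟨x, hx⟩ : ↥(tower O A m)) ∈ P)
    {x : K} (hxca : x ∈ ca (tower O A m)) (hx0 : x ≠ 0) (hxmin : ∀ c ∈ ca (tower O A m), c * x⁻¹ ∈ O)
    (B : Subalgebra k K)
    (hB : B = Algebra.adjoin k ((locPrime (tower O A m) P hP : Set K) ∪
      {y : K | ∃ c ∈ ca (tower O A m), y = c * x⁻¹})) :
    (nrm B : Set K) ⊆ locPrime (tower O A (m + 1)) P' hP' := by
  haveI := hfr
  haveI : IsIntegrallyClosed ↥(tower O A (m + 1)) := d2rc_isIntegrallyClosed_tower_succ O A hk hA hfr hAO m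
  haveI : IsFractionRing ↥(tower O A (m + 1)) K :=
    Literature.AlgebraicGeometry.Resolution.isFractionRing_subalgebra_of_le A _
      (tn_tower_invariant O A hk hA hfr hAO (m + 1)).1
  intro y hy
  exact mem_locPrime_of_isIntegral (tower O A (m + 1)) P' hP' B
    (adjoin_locPrime_le_locPrime_succ O A m P hP P' hP' hcompat hxca hx0 hxmin B hB)
    ((SyzygyFlattening.mem_nrm_iff B).mp hy)

/-- **(S3)** In `D_(m+1)` the extended centre ideal is generated by the admissible denominator:
`ca(T_m) · D_(m+1) = x · D_(m+1)`. [this work] -/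
theorem span_ca_eq_span_singleton (m : ℕ) (P' : Ideal ↥(tower O A (m + 1))) (hP' : P'.IsPrime)
    {x : K} (hxca : x ∈ ca (tower O A m)) (hx0 : x ≠ 0) (hxmin : ∀ c ∈ ca (tower O A m), c * x⁻¹ ∈ O)
    (hxD : x ∈ locPrime (tower O A (m + 1)) P' hP') :
    Ideal.span {d : ↥(locPrime (tower O A (m + 1)) P' hP') | (d : K) ∈ ca (tower O A m)} =
      Ideal.span {(⟨x, hxD⟩ : ↥(locPrime (tower O A (m + 1)) P' hP'))} := by
  apply le_antisymm
  · refine Ideal.span_le.mpr fun d hd => ?_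
    have hq : (d : K) * x⁻¹ ∈ locPrime (tower O A (m + 1)) P' hP' :=
      mem_locPrime_of_mem _ _ _ (mul_inv_mem_tower_succ O A m hxca hx0 hxmin hd)
    rw [SetLike.mem_coe, Ideal.mem_span_singleton']
    refine ⟨⟨(d : K) * x⁻¹, hq⟩, Subtype.ext ?_⟩
    change (d : K) * x⁻¹ * x = d
    rw [mul_assoc, inv_mul_cancel₀ hx0, mul_one]
  · exact Ideal.span_mono (Set.singleton_subset_iff.mpr hxca)

/-- **THREAD STEP (S2): `D_(m+1)` is the local ring of the normalised blow-up of `D_m` along `I_m`.**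
Along a compatible pair of thread primes `P ⊆ T_m`, `P' ⊆ T_(m+1)`, with `D_m := (T_m)_P`, `D_(m+1) := (T_(m+1))_(P')`
(`Parasite.locPrime`), `x ∈ ca(T_m)` ANY admissible denominator (nonzero, of minimal `O`-value) and
`B := k[D_m ∪ ca(T_m)·x⁻¹]` (the `x`-chart of `Bl_(I_m) D_m`): the prime `𝔮` of `nrm B` consisting of the
non-units of `D_(m+1)` satisfies **`(nrm B)_𝔮 = D_(m+1)`** as subrings of `K`.  Proof: `(nrm B)_𝔮 ≤ D_(m+1)` by (S1b);
conversely `(nrm B)_𝔮` is saturated for `D_(m+1)`-units, contains the whole `O`-chart `T_m[ca/x']` (every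
`x'·x⁻¹` is a unit), hence its normalisation `N` (integrality descends along the localisation), hence
`T_(m+1) = loc O N` and `(T_(m+1))_(P')`. [this work] -/
theorem locPrime_succ_eq_locPrime_nrm_adjoin (hk : ∀ c : k, algebraMap k K c ∈ O) (hA : A.FG)
    (hfr : IsFractionRing ↥A K) (hAO : A.toSubring ≤ O.toSubring)
    (m : ℕ) (P : Ideal ↥(tower O A m)) (hP : P.IsPrime)
    (P' : Ideal ↥(tower O A (m + 1))) (hP' : P'.IsPrime)
    (hcompat : ∀ (x : K) (hx : x ∈ tower O A m) (hx' : x ∈ tower O A (m + 1)),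
      (⟨x, hx'⟩ : ↥(tower O A (m + 1))) ∈ P' → (⟨x, hx⟩ : ↥(tower O A m)) ∈ P)
    {x : K} (hxca : x ∈ ca (tower O A m)) (hx0 : x ≠ 0) (hxmin : ∀ c ∈ ca (tower O A m), c * x⁻¹ ∈ O)
    (B : Subalgebra k K)
    (hB : B = Algebra.adjoin k ((locPrime (tower O A m) P hP : Set K) ∪
      {y : K | ∃ c ∈ ca (tower O A m), y = c * x⁻¹})) :
    ∃ (𝔮 : Ideal ↥(nrm B)) (h𝔮 : 𝔮.IsPrime),
      locPrime (nrm B) 𝔮 h𝔮 = locPrime (tower O A (m + 1)) P' hP' ∧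
        ∀ b : ↥(nrm B), b ∉ 𝔮 ↔ ((b : K) ≠ 0 ∧ (b : K)⁻¹ ∈ locPrime (tower O A (m + 1)) P' hP') := by
  haveI := hfr
  have hnrm : (nrm B : Set K) ⊆ locPrime (tower O A (m + 1)) P' hP' :=
    nrm_adjoin_locPrime_le_locPrime_succ O A hk hA hfr hAO m P hP P' hP' hcompat hxca hx0 hxmin B hB
  have hnrm' : (nrm B).toSubring ≤ locPrime (tower O A (m + 1)) P' hP' := fun y hy => hnrm hy
  haveI : IsLocalRing ↥(locPrime (tower O A (m + 1)) P' hP') := Parasite.isLocalRing_locPrime _ _ _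
  let f : ↥(nrm B) →+* ↥(locPrime (tower O A (m + 1)) P' hP') := Subring.inclusion hnrm'
  let 𝔮 : Ideal ↥(nrm B) := (maximalIdeal ↥(locPrime (tower O A (m + 1)) P' hP')).comap f
  have h𝔮 : 𝔮.IsPrime := Ideal.comap_isPrime f _
  have hmem : ∀ b : ↥(nrm B), b ∉ 𝔮 ↔
      ((b : K) ≠ 0 ∧ (b : K)⁻¹ ∈ locPrime (tower O A (m + 1)) P' hP') := by
    intro b
    change ¬ (f b ∈ maximalIdeal _) ↔ _
    rw [IsLocalRing.mem_maximalIdeal, mem_nonunits_iff, not_not]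
    exact Literature.AlgebraicGeometry.Resolution.isUnit_subring_iff_inv_mem (f b)
  refine ⟨𝔮, h𝔮, ?_, hmem⟩
  obtain ⟨hle, hsat⟩ :=
    locPrime_le_and_saturated (tower O A (m + 1)) P' hP' (nrm B) hnrm 𝔮 h𝔮 hmem
  apply le_antisymm (fun y hy => hle hy)
  -- `⊇`: write `L := (nrm B)_𝔮`, `D' := D_(m+1)`
  set L := locPrime (nrm B) 𝔮 h𝔮 with hL
  have hBL : (B : Set K) ⊆ L := fun y hy =>
    mem_locPrime_of_mem _ _ _ (SyzygyFlattening.self_le_nrm B hy)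
  have hgenL : ∀ c ∈ ca (tower O A m), c * x⁻¹ ∈ L := fun c hc =>
    hBL (by rw [hB]; exact Algebra.subset_adjoin (Or.inr ⟨c, hc, rfl⟩))
  have hTL : (tower O A m : Set K) ⊆ L := fun y hy =>
    hBL (by rw [hB]; exact Algebra.subset_adjoin (Or.inl (mem_locPrime_of_mem _ _ _ hy)))
  -- the whole `O`-chart lies in `L`
  have hchartL : (chart O (tower O A m) : Set K) ⊆ L := by
    refine adjoin_subset_of_subset _ (fun c => hTL ((tower O A m).algebraMap_mem c)) ?_
    rintro y (hy | ⟨c, hc, x', hx'ca, hx'0, hx'min, rfl⟩)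
    · exact hTL hy
    · have h1 : c * x⁻¹ ∈ L := hgenL c hc
      have h2 : x' * x⁻¹ ∈ L := hgenL x' hx'ca
      have h3 : (x' * x⁻¹)⁻¹ ∈ locPrime (tower O A (m + 1)) P' hP' := by
        rw [mul_inv, inv_inv, mul_comm]
        exact mem_locPrime_of_mem _ _ _ (mul_inv_mem_tower_succ O A m hx'ca hx'0 hx'min hxca)
      have h4 : (x' * x⁻¹)⁻¹ ∈ L := hsat _ h2 h3
      have heq : c * x'⁻¹ = (c * x⁻¹) * (x' * x⁻¹)⁻¹ := by field_simp
      rw [heq]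
      exact L.mul_mem h1 h4
  have hchartL' : (chart O (tower O A m)).toSubring ≤ L := fun y hy => hchartL hy
  -- its normalisation lies in `L` (integrality descends along the localisation `nrm B → L`)
  have hNL : (nrm (chart O (tower O A m)) : Set K) ⊆ L := by
    intro y hy
    have hint : IsIntegral ↥(chart O (tower O A m)) y := (SyzygyFlattening.mem_nrm_iff _).mp hy
    letI algCL : Algebra ↥(chart O (tower O A m)) ↥L := (Subring.inclusion hchartL').toAlgebra
    haveI : IsScalarTower ↥(chart O (tower O A m)) ↥L K := IsScalarTower.of_algebraMap_eq fun _ => rfl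
    have hintL : IsIntegral ↥L y := hint.tower_top
    letI algNL : Algebra ↥(nrm B) ↥L := (Subring.inclusion (toSubring_le_locPrime (nrm B) 𝔮 h𝔮)).toAlgebra
    haveI := isLocalization_locPrime (nrm B) 𝔮 h𝔮
    haveI : IsScalarTower ↥(nrm B) ↥L K := IsScalarTower.of_algebraMap_eq fun _ => rfl
    obtain ⟨⟨s, hs𝔮⟩, hsy⟩ := IsIntegral.exists_multiple_integral_of_isLocalization 𝔮.primeCompl y hintL
    have hsy' : IsIntegral ↥(nrm B) ((s : K) * y) := by simpa [Algebra.smul_def] using hsy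
    -- integral over `nrm B` ⇒ integral over `B` ⇒ in `nrm B`
    have hsyB : IsIntegral ↥B ((s : K) * y) := by
      letI : Algebra ↥B ↥(nrm B) := (Subalgebra.inclusion (SyzygyFlattening.self_le_nrm B)).toRingHom.toAlgebra
      haveI : IsScalarTower ↥B ↥(nrm B) K := IsScalarTower.of_algebraMap_eq fun _ => rfl
      haveI : Algebra.IsIntegral ↥B ↥(nrm B) := SyzygyFlattening.isIntegral_nrm B
      exact isIntegral_trans _ hsy'
    have hmemN : (s : K) * y ∈ nrm B := (SyzygyFlattening.mem_nrm_iff B).mpr hsyB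
    have hs𝔮' : s ∉ 𝔮 := hs𝔮
    have hs0 : (s : K) ≠ 0 := ((hmem s).mp hs𝔮').1
    have heq : y = ((s : K) * y) * (s : K)⁻¹ := by field_simp
    rw [heq]
    exact ⟨(s : K) * y, s, hmemN, s.2, hs𝔮', rfl⟩
  -- `T_(m+1) = loc O N ⊆ L` and then `D_(m+1) ⊆ L`, by saturation
  have hT'O : (tower O A (m + 1)).toSubring ≤ O.toSubring := (tn_tower_invariant O A hk hA hfr hAO (m + 1)).2.1
  have hNT' : nrm (chart O (tower O A m)) ≤ tower O A (m + 1) := by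
    rw [tower_succ, loc_eq_locAt]; exact SyzygyFlattening.self_le_locAt O _
  have hNO : (nrm (chart O (tower O A m))).toSubring ≤ O.toSubring := fun y hy => hT'O (hNT' hy)
  have hT'L : (tower O A (m + 1) : Set K) ⊆ L := by
    intro y hy
    have hy' : y ∈ SyzygyFlattening.locAt O (nrm (chart O (tower O A m))) := by
      rw [← loc_eq_locAt, ← tower_succ]; exact hy
    obtain ⟨a, ha, s, hs, hvs, rfl⟩ := (SyzygyFlattening.mem_locAt_iff O _ hNO).mp hy'
    have hsinvT' : s⁻¹ ∈ tower O A (m + 1) := by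
      rw [tower_succ, loc_eq_locAt]
      exact SyzygyFlattening.inv_mem_locAt O _ hNO (SyzygyFlattening.self_le_locAt O _ hs) hvs
    exact L.mul_mem (hNL ha) (hsat s (hNL hs) (mem_locPrime_of_mem _ _ _ hsinvT'))
  rintro y ⟨a, b, ha, hb, hbP', rfl⟩
  exact L.mul_mem (hT'L ha) (hsat b (hT'L hb) (inv_mem_locPrime_of_not_mem _ _ _ hb hbP'))

end Step

end Summit.ResolutionOfSingularities.ResolutionOfSingularities.Theorems.NoZeno.SandwichCluster.Thread

end
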